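import Summits.QuantumFields.YangMills.Theorems.ScalingWindowSplitSelfNormalisedSkewnessWitnessDefs
import Literature.MathematicalPhysics.QuantumFieldTheory.AbelianTorusCochains
import Literature.MathematicalPhysics.QuantumFieldTheory.LatticeGaugeProofs
import HarnessLib

/-!
# `SelfNormalisedSkewness` — negative side: no torus flux at small plaquette angles

Route `ScalingWindowSplit`, crux `stmt-QuantumFields-18944`, line `Sketch` (negation branch), support for the
lead's `stub_witnessAssembly`.  For `U(1)` on `(ℤ/S)⁴`: if every plaquette angle `ω_p(U) = arg U_p` is smaller
than `ε` with `S⁴ ε ≤ 2π` and `6 ε ≤ 2π`, then the vector of plaquette angles is EXACT, `ω(U) = d θ'` for a real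
link field `θ'` — i.e. the small-field region is a chart of the space `V = im d` of the lattice-Maxwell
Gaussian.  Proof: `ω ≡ d(arg ∘ U) (mod 2π)` coordinatewise, so `ω` is closed up to `2π ×` an integer cube flux of
size `< 6ε`, hence closed, and has total sums in `2πℤ` of size `< S⁴ε`, hence zero; the registered stub
`stub_torusTwoFormExact` (closed, zero-mean real 2-cochains on the discrete 4-torus are exact) is taken as a
hypothesis `hExact` (it is discharged by name in the final assembly).

References: Lüscher, Nucl. Phys. B 549 (1999) §3 (admissible abelian fields).  No definitions of propositions,
no named facts.
-/

noncomputable section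

open scoped BigOperators
open Literature.MathematicalPhysics.QuantumLattice Literature.MathematicalPhysics.QuantumFieldTheory
open Literature.Probability.LatticeModels (TorusSite torusGreen)

namespace Summit.QuantumFields.YangMills.Theorems.SelfNormalisedSkewness.Negative


variable {S : ℕ}

/-! ### Plaquette angles are the coboundary of the link arguments modulo `2π` -/

/-- The plaquette holonomy of `U(1)` is the exponential of the coboundary of the link arguments:
`U_p = exp(i (d (arg ∘ U))_p)`. [folklore] -/
theorem plaquetteHolonomy_eq_exp_plaqCoboundary_arg (U : GaugeConfig 4 S Circle) (p : Plaquette 4 S) :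
    plaquetteHolonomy U p.1 p.2.1.1 p.2.1.2 =
      Circle.exp (plaqCoboundary S (fun e => Complex.arg (U e : ℂ)) p) := by
  obtain ⟨x, q⟩ := p
  rw [plaqCoboundary_apply, plaquetteHolonomy, Circle.exp_sub, Circle.exp_sub, Circle.exp_add, Circle.exp_arg,
    Circle.exp_arg, Circle.exp_arg, Circle.exp_arg, div_eq_mul_inv, div_eq_mul_inv]
  rfl

/-- **`ω ≡ d(arg ∘ U) (mod 2π)`**: there is an integer plaquette field `m` with
`(d (arg ∘ U))_p = ω_p(U) + 2π m_p` for every plaquette. [folklore] -/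
theorem exists_int_plaqCoboundary_arg_eq (U : GaugeConfig 4 S Circle) :
    ∃ m : Plaquette 4 S → ℤ, ∀ p, plaqCoboundary S (fun e => Complex.arg (U e : ℂ)) p =
      plaqAngle U p + m p * (2 * Real.pi) := by
  have h : ∀ p : Plaquette 4 S, ∃ m : ℤ, plaqCoboundary S (fun e => Complex.arg (U e : ℂ)) p =
      plaqAngle U p + m * (2 * Real.pi) := fun p => by
    rw [← Circle.exp_eq_exp, ← plaquetteHolonomy_eq_exp_plaqCoboundary_arg, plaqAngle_apply,
      exp_abelianFieldTensor]
  exact ⟨fun p => (h p).choose, fun p => (h p).choose_spec⟩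

/-! ### Alternating 2-cochains from plaquette vectors -/

/-- The alternating 2-cochain `(x; i, j) ↦ ±ω(x; min, max)` attached to a plaquette vector `ω` (indexed by
`i < j`). [folklore] -/
def altOf {A : Type*} [AddCommGroup A] (ω : Plaquette 4 S → A) : Site 4 S → Fin 4 → Fin 4 → A :=
  fun x i j => if h : i < j then ω (x, ⟨(i, j), h⟩) else if h' : j < i then -ω (x, ⟨(j, i), h'⟩) else 0

/-- `altOf ω` at an increasing pair is `ω`. [folklore] -/
theorem altOf_of_lt {A : Type*} [AddCommGroup A] (ω : Plaquette 4 S → A) (x : Site 4 S) {i j : Fin 4}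
    (h : i < j) : altOf ω x i j = ω (x, ⟨(i, j), h⟩) := by
  simp [altOf, h]

/-- `altOf ω` is alternating. [folklore] -/
theorem isAlt_altOf {A : Type*} [AddCommGroup A] (ω : Plaquette 4 S → A) : LatticeForm.IsAlt (altOf ω) := by
  refine ⟨fun x i j => ?_, fun x i => by simp [altOf]⟩
  unfold altOf
  rcases lt_trichotomy i j with h | h | h
  · simp [h, not_lt.2 h.le]
  · subst h; simp
  · simp [h, not_lt.2 h.le]

/-- `altOf` is additive. [folklore] -/
theorem altOf_add {A : Type*} [AddCommGroup A] (ω ω' : Plaquette 4 S → A) :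
    altOf (ω + ω') = altOf ω + altOf ω' := by
  funext x i j
  simp only [altOf, Pi.add_apply]
  split_ifs <;> abel

/-- `altOf` commutes with integer casts. [folklore] -/
theorem altOf_intCast (m : Plaquette 4 S → ℤ) :
    altOf (fun p => (m p : ℝ)) = fun x i j => ((altOf m x i j : ℤ) : ℝ) := by
  funext x i j
  simp only [altOf]
  split_ifs <;> simp

/-- `altOf` of a scalar multiple. [folklore] -/
theorem altOf_mul_const (ω : Plaquette 4 S → ℝ) (c : ℝ) :
    altOf (fun p => ω p * c) = fun x i j => altOf ω x i j * c := by
  funext x i j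
  simp only [altOf]
  split_ifs <;> simp [neg_mul]

/-- **The coboundary in alternating form**: `altOf (d θ) = td₁ θ` (curried link field). [folklore] -/
theorem altOf_plaqCoboundary (θ : Edge 4 S → ℝ) :
    altOf (fun p => plaqCoboundary S θ p) = LatticeForm.td₁ (fun x i => θ (x, i)) := by
  funext x i j
  rcases lt_trichotomy i j with h | h | h
  · rw [altOf_of_lt _ _ h, plaqCoboundary_apply]
    simp [LatticeForm.td₁, LatticeForm.te]
  · subst h
    rw [LatticeForm.td₁_self]
    simp [altOf]
  · rw [(isAlt_altOf _).1 x j i, LatticeForm.td₁_swap, altOf_of_lt _ _ h, plaqCoboundary_apply]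
    simp [LatticeForm.td₁, LatticeForm.te]

/-- `td₂` commutes with integer casts. [folklore] -/
theorem td₂_intCast (f : Site 4 S → Fin 4 → Fin 4 → ℤ) :
    LatticeForm.td₂ (fun x i j => (f x i j : ℝ)) = fun x i j k => ((LatticeForm.td₂ f x i j k : ℤ) : ℝ) := by
  funext x i j k
  simp only [LatticeForm.td₂]
  push_cast
  ring

/-- Sums of a coboundary over the torus vanish: `Σ_x (td₁ θ)(x; μ, ν) = 0` (telescoping). [folklore] -/
theorem sum_td₁_eq_zero [NeZero S] (θ : Site 4 S → Fin 4 → ℝ) (μ ν : Fin 4) :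
    ∑ x : Site 4 S, LatticeForm.td₁ θ x μ ν = 0 := by
  simp only [LatticeForm.td₁, Finset.sum_sub_distrib, Finset.sum_add_distrib]
  have h1 : ∑ x : Site 4 S, θ (x + LatticeForm.te μ) ν = ∑ x : Site 4 S, θ x ν :=
    Fintype.sum_equiv (Equiv.addRight (LatticeForm.te μ)) _ _ fun x => rfl
  have h2 : ∑ x : Site 4 S, θ (x + LatticeForm.te ν) μ = ∑ x : Site 4 S, θ x μ :=
    Fintype.sum_equiv (Equiv.addRight (LatticeForm.te ν)) _ _ fun x => rfl
  rw [h1, h2]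
  ring

/-- A real number that is an integer multiple of `2π` and smaller than `2π` in size is `0`. [folklore] -/
theorem eq_zero_of_intCast_mul_two_pi_of_abs_lt {t : ℝ} {k : ℤ} (hk : t = k * (2 * Real.pi))
    (ht : |t| < 2 * Real.pi) : t = 0 := by
  subst hk
  have h2 : (0 : ℝ) < 2 * Real.pi := by positivity
  have : |(k : ℝ)| < 1 := by
    rw [abs_mul, abs_of_pos h2] at ht
    by_contra hc
    push Not at hc
    have := mul_le_mul_of_nonneg_right hc h2.le
    linarith
  have hk0 : k = 0 := by
    have : |k| < 1 := by exact_mod_cast this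
    exact Int.abs_lt_one_iff.1 this
  simp [hk0]

/-- **No torus flux at small plaquette angles.**  Assume the exactness of closed zero-mean real 2-cochains on the
discrete 4-torus (the registered stub `stub_torusTwoFormExact`, hypothesis `hExact`).  If `S⁴ ε ≤ 2π`,
`6ε ≤ 2π` and every plaquette angle of `U` satisfies `|ω_p(U)| < ε`, then `ω(U)` lies in the range of the real
plaquette coboundary: `ω(U) = d θ'` for a real link field `θ'`. [folklore] -/
theorem plaqAngle_mem_range_of_small [NeZero S]
    (hExact : ∀ (S : ℕ) [NeZero S] (ω : Site 4 S → Fin 4 → Fin 4 → ℝ),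
      LatticeForm.IsAlt ω → LatticeForm.td₂ ω = 0 → (∀ μ ν : Fin 4, ∑ x : Site 4 S, ω x μ ν = 0) →
      ∃ θ : Site 4 S → Fin 4 → ℝ, LatticeForm.td₁ θ = ω)
    {ε : ℝ} (hSε : (S : ℝ) ^ 4 * ε ≤ 2 * Real.pi) (h6 : 6 * ε ≤ 2 * Real.pi)
    (U : GaugeConfig 4 S Circle) (hU : ∀ p, |plaqAngle U p| < ε) :
    plaqAngle U ∈ LinearMap.range (plaqCoboundary S) := by
  classical
  obtain ⟨m, hm⟩ := exists_int_plaqCoboundary_arg_eq U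
  set θ : Edge 4 S → ℝ := fun e => Complex.arg (U e : ℂ) with hθ
  set ω : Plaquette 4 S → ℝ := fun p => plaqAngle U p with hω
  set r := altOf ω with hr
  -- `r = td₁ θc - 2π altOf m`
  have hdecomp : r = LatticeForm.td₁ (fun x i => θ (x, i)) - fun x i j => ((altOf m x i j : ℤ) : ℝ) * (2 * Real.pi) := by
    have e1 : (fun p => plaqCoboundary S θ p) = ω + fun p => (m p : ℝ) * (2 * Real.pi) := by
      funext p; simp [hm p, hω]
    rw [← altOf_plaqCoboundary, e1, altOf_add]
    have e2 : altOf (fun p => (m p : ℝ) * (2 * Real.pi)) = fun x i j => ((altOf m x i j : ℤ) : ℝ) * (2 * Real.pi) := by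
      rw [altOf_mul_const (fun p => (m p : ℝ)) (2 * Real.pi), altOf_intCast]
    rw [e2, hr]
    abel
  -- smallness of `r`
  have hsmall : ∀ x i j, |r x i j| < ε := by
    intro x i j
    have hε : 0 < ε := by
      have := hU ((0 : Site 4 S), ⟨((0 : Fin 4), (1 : Fin 4)), by decide⟩)
      exact (abs_nonneg _).trans_lt this
    simp only [hr, altOf]
    split_ifs with h h'
    · exact hU _
    · rw [abs_neg]; exact hU _
    · simpa using hε
  -- closedness
  have hclosed : LatticeForm.td₂ r = 0 := by
    funext x i j k
    have hint : LatticeForm.td₂ r x i j k = (-(LatticeForm.td₂ (altOf m) x i j k : ℤ) : ℝ) * (2 * Real.pi) := by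
      rw [hdecomp]
      have : LatticeForm.td₂ (LatticeForm.td₁ (fun x i => θ (x, i)) -
          fun x i j => ((altOf m x i j : ℤ) : ℝ) * (2 * Real.pi)) x i j k =
          LatticeForm.td₂ (LatticeForm.td₁ (fun x i => θ (x, i))) x i j k -
            LatticeForm.td₂ (fun x i j => ((altOf m x i j : ℤ) : ℝ) * (2 * Real.pi)) x i j k := by
        simp only [LatticeForm.td₂, Pi.sub_apply]; ring
      rw [this, LatticeForm.td₂_td₁]
      simp only [Pi.zero_apply, zero_sub, LatticeForm.td₂]
      push_cast
      ring
    have hlt : |LatticeForm.td₂ r x i j k| < 2 * Real.pi := by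
      have hb : |LatticeForm.td₂ r x i j k| < 6 * ε := by
        simp only [LatticeForm.td₂]
        have h1 := hsmall (x + LatticeForm.te i) j k; have h2 := hsmall x j k
        have h3 := hsmall (x + LatticeForm.te j) i k; have h4 := hsmall x i k
        have h5 := hsmall (x + LatticeForm.te k) i j; have h6 := hsmall x i j
        rw [abs_lt] at h1 h2 h3 h4 h5 h6 ⊢
        constructor <;> linarith [h1.1, h1.2, h2.1, h2.2, h3.1, h3.2, h4.1, h4.2, h5.1, h5.2, h6.1, h6.2]
      linarith
    simpa using eq_zero_of_intCast_mul_two_pi_of_abs_lt (k := -LatticeForm.td₂ (altOf m) x i j k)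
      (by rw [hint]; push_cast; ring) hlt
  -- zero total sums
  have hflux : ∀ μ ν : Fin 4, ∑ x : Site 4 S, r x μ ν = 0 := by
    intro μ ν
    have hint : ∑ x : Site 4 S, r x μ ν = (-(∑ x : Site 4 S, altOf m x μ ν : ℤ) : ℝ) * (2 * Real.pi) := by
      rw [hdecomp]
      simp only [Pi.sub_apply, Finset.sum_sub_distrib, sum_td₁_eq_zero, zero_sub, ← Finset.sum_mul]
      push_cast
      ring
    have hlt : |∑ x : Site 4 S, r x μ ν| < 2 * Real.pi := by
      have hε : 0 < ε := (abs_nonneg _).trans_lt (hsmall 0 μ ν)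
      calc |∑ x : Site 4 S, r x μ ν| ≤ ∑ x : Site 4 S, |r x μ ν| := Finset.abs_sum_le_sum_abs _ _
        _ < ∑ _x : Site 4 S, ε := Finset.sum_lt_sum (fun x _ => (hsmall x μ ν).le)
            ⟨0, Finset.mem_univ _, hsmall 0 μ ν⟩
        _ = (S : ℝ) ^ 4 * ε := by
            rw [Finset.sum_const, Finset.card_univ, nsmul_eq_mul]
            simp [ZMod.card]
        _ ≤ 2 * Real.pi := hSε
    exact eq_zero_of_intCast_mul_two_pi_of_abs_lt (k := -∑ x : Site 4 S, altOf m x μ ν)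
      (by rw [hint]; push_cast; ring) hlt
  -- exactness
  obtain ⟨θ', hθ'⟩ := hExact S r (isAlt_altOf ω) hclosed hflux
  refine ⟨fun e => θ' e.1 e.2, ?_⟩
  ext ⟨x, ⟨⟨i, j⟩, hij⟩⟩
  have h1 : plaqCoboundary S (fun e => θ' e.1 e.2) (x, ⟨(i, j), hij⟩) = LatticeForm.td₁ θ' x i j := by
    rw [plaqCoboundary_apply]; simp [LatticeForm.td₁, LatticeForm.te]
  rw [h1, hθ', hr, altOf_of_lt _ _ hij]


end Summit.QuantumFields.YangMills.Theorems.SelfNormalisedSkewness.Negative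

end
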